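import Summits.BirchSwinnertonDyer.BirchSwinnertonDyer.Theorems.CountingDoorF2AtThreeNonCubeDoor
import HarnessLib

/-!
# BirchSwinnertonDyer / CountingDoorF2AtThree — the door AT `p = 2` is NOT shut: Bhargava–Ho's PROVED
# `2`-Selmer average `≤ 12` (Thm 1.1(g)/1.2) + «dens{#Sel₂(E_a) = 8} < 1/2» (Y₂) give `rank = 2 ∧ Ш[2^∞] = 0`
# for a positive proportion of every large subfamily of `F₂`

Route `route-BirchSwinnertonDyer-CountingDoorF2AtThree` (cell bsd-rank2; TWIN leaf T-r2
`PAdicBSDRankTwoPositiveProportion` at `p = 3`; KILL-CRITERIA fallback leaf «rank 2 ∧ Ш[p^∞] = 0 for a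
positive proportion»). Seat bsd-rank2-rootno-p2 GEN 5; sequel to `CountingDoorF2AtThreeNonCubeDoor`
(p561136: the first-moment door at `p` consumes exactly a lower density `κ` of `{#Sel_p ≠ p³}`, threshold
`A < p³ + (p⁴ − p³)κ`).

THE FINDING. The route's NUMBERS paragraph and the crux ideation census (B-β, §4) record the door at
`p = 2` as shut: the ROOT-NUMBER door needs `ρ > (A − 8)/8 = 1/2` at `A = 12` (Poonen–Rains: `ρ = 1/2`, a dead
tie) and the TAIL door needs `dens{#Sel₂ ≥ 16} > 1/2` (Poonen–Rains quotient model: `.371` — false). But the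
door's EXACT input is the level set (p561136): at `p = 2`, `A = 12`,

  (Y₂)  «in every large `Φ ⊆ F₂` with nonempty residue sets, `liminf dens{a : #Sel₂(E_a) ≠ 8} > 1/2`»,
        i.e. «`#Sel₂ = 8` has upper density `< 1/2`»,

and the Poonen–Rains value is `y₂ = P(dim X = 1) = 2·∏_{j≥0}(1 + 2^{−j})^{−1} = 0.419 < 1/2` (margin
`0.081`): sign and odd tail ADD (`x₂ + z₂ = .210 + .371 = .581 > 1/2`) where neither alone suffices. And at
`p = 2` the first moment is a THEOREM IN PRINT — Bhargava–Ho 2022, Thm 1.1(g) + Thm 1.2: «the average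
size of the 2-Selmer group in F₂ is at most 12 … even when one averages over any large subfamily», «at
most N means that the limsup of the corresponding ratio is at most N» — i.e. exactly
`∀ Φ, Φ.IsLarge → Φ.AverageOnLE (fun a ↦ #Sel₂(E_a)) 12` (taken here as the explicit hypothesis `hBH`;
its transcription as a named Literature fact `BhargavaHo2022.thm1_2_F2_selmerTwo` is filed separately).
Hence, modulo PRINT (BH Thm 1.1(g)/1.2, and BH Thm 9.1/10.1 = `LargeFamilyInputsF2` for genericity —
or NOTHING on the refined door family, where genericity is member-wise) and the ONE open input Y₂:

  «in every large `Φ ⊆ F₂` with nonempty residue sets, the members with `rank E_a(ℚ) = 2` EXACTLY and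
   `Ш(E_a)[2^∞] = 0` have positive lower density»  (`weakLeafAtTwo_of_selmerTwoAverage_of_neCubeTwo`),

by pure counting (K1 at `p = 2`; no parity, no modularity, no Iwasawa theory, no height). This is a
ONE-CRUX sibling of the route's two-crux cone {I1 (XL, capped method), I2 (XL, parity wall)}.

* §1 `hasPositiveLowerDensityOn_selmerFour_of_selmerTwoAverage_of_neCubeTwo` (Φ-local: `100 %` good at `2`
  + `limsup avg #Sel₂ ≤ A` + `liminf dens{#Sel₂ ≠ 8} ≥ κ` + `A < 8 + 8κ` ⇒ `dens{#Sel₂ = 4} > 0`; via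
  `averageOnLE_min` and the master door at `2`), `hasPositiveLowerDensityOn_rank_two_sha_two_of_…` (⇒ weak leaf
  at `2`, K1), `threshold_two` (`12 < 8 + 8κ ↔ 1/2 < κ`).
* §2 BY NAME over large families: `selmerFourDensity_of_selmerTwoAverage_of_neCubeTwo` (LFI → hBH → Y₂ → D4 on
  every large Φ), **`weakLeafAtTwo_of_selmerTwoAverage_of_neCubeTwo`** (LFI → hBH → Y₂ → weak leaf at `2` on
  every large Φ with nonempty residue sets), `weakLeafAtTwo_all_…` (on `F₂` itself), and
  `exists_weakLeafAtTwo_of_selmerTwoAverage_of_neCubeTwo` (hBH → Y₂ → on the refined door family — NO fact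
  pack: genericity is member-wise there).
* §3 feeders of Y₂: `neCubeTwoDensity_of_rootNumber_add_oddTail` (modulo LFI and Dokchitser–Dokchitser /
  Monsky `2`-parity: `liminf dens{w = +1} ≥ ρ` and `liminf dens{w = −1 ∧ #Sel₂ ≥ 16} ≥ z` with `ρ + z > 1/2`
  ⇒ Y₂), `neCubeTwoDensity_of_selmerTwoTail` (`dens{#Sel₂ ≥ 16} > 1/2` ⇒ Y₂; numerically false under PR,
  recorded for completeness).

NUMBERS (cell census, eng `data/f2door/census.jsonl.gz`, tuple-weighted, `H < 10⁶/10⁷/10⁸`): avg #Sel₂ =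
`6.02/6.68/7.45` (limit ≤ 12); `dens{#Sel₂ = 4} = .550/.471/.400` (PR `.210`), `dens{#Sel₂ = 8} = .394/.446/.473`
(PR `.419`; Y₂ needs `< 1/2` IN THE LIMIT), `dens{#Sel₂ ≥ 16} = .039/.075/.124` (PR `.371`). The finite-height
level `8` is still filling from level `4` and has not begun to drain into `≥ 16`; the instrument decides
nothing about the limit. HONESTY: Y₂ is OPEN (as Y, Z, I2 at `3`: it needs a sign or a second `2`-Selmer
class beyond the marked ones on a positive proportion; Bhargava–Ho's hypercube count gives the MEAN only);
its margin under Poonen–Rains is thin (`.081`); nothing here proves it; nothing reads an analytic rank (B1); no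
S0 motion; BSD is not proved by any of this. THEOREMS ONLY; no definition, no named fact beyond explicit
hypotheses, no `sorry`; standard axioms. PARTITION: none — r_an ≥ 2, summit axis S0; TWIN (D-0056): n/a.

References: M. Bhargava, W. Ho, arXiv:2207.03309 (2022) Thm. 1.1(g), Thm. 1.2 and the sentence after
Thm. 1.1 («at most N means limsup ≤ N») (§1, p. 2), Thm. 9.1/10.1 [BhargavaHo2022]; B. Poonen, E. Rains,
J. AMS 25 (2012) §2 [PoonenRains2012]; T. and V. Dokchitser, Ann. of Math. 172 (2010) Thm 1.4;
P. Monsky, Math. Z. 221 (1996) (2-parity) [DokchitserDokchitserAnnals2010]; M. Bhargava, A. Shankar, Ann. of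
Math. 181 (2015) §1 [BhargavaShankarTernary2015].
-/

set_option linter.dupNamespace false

noncomputable section

open scoped Classical
open Filter Topology Finset
open WeierstrassCurve Literature.NumberTheory.EllipticCurves
  Literature.NumberTheory.EllipticCurves.BhargavaHo2022
  Summit.BirchSwinnertonDyer.Rank2
  Summit.BirchSwinnertonDyer.BirchSwinnertonDyer.Theses.CountingDoorF2AtThree

namespace Summit.BirchSwinnertonDyer.BirchSwinnertonDyer.Theorems

variable (Φ : CongruenceFamily₂)

/-! ### §1 The door at `p = 2`, Φ-local -/

/-- The threshold of the door at `p = 2` with Bhargava–Ho's average `12`: `12 < 8 + 8κ ↔ 1/2 < κ`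
(`A < p³ + (p⁴ − p³)κ` at `p = 2`). [cite: BhargavaHo2022, Thm. 1.1(g) (average 2-Selmer size in F₂ at most 12)] -/
theorem threshold_two (κ : ℝ) : (12 : ℝ) < 8 + 8 * κ ↔ 1 / 2 < κ := by
  constructor <;> intro h <;> linarith

/-- **The door at `p = 2`, Φ-local.** On a `Φ ⊆ F₂` on which `rank ≥ 2 ∧ #E(ℚ)[2] = 1` holds for `100 %`:
an (uncapped) `2`-Selmer average `limsup avg #Sel₂(E_a) ≤ A`, a lower density
`liminf dens{a : #Sel₂(E_a) ≠ 8} ≥ κ > 0` and `A < 8 + 8κ` give a POSITIVE LOWER DENSITY of members with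
`#Sel₂(E_a) = 4` (cap at `16` by `averageOnLE_min`, then the master door
`hasPositiveLowerDensityOn_card_selmerGroup_eq_sq_of_cappedAverage_of_neCube` at `p = 2`). With
Bhargava–Ho's `A = 12` the threshold is `κ > 1/2` (`threshold_two`). No parity, no tail.
[cite: BhargavaShankarTernary2015, §1 (first-moment method)] -/
theorem hasPositiveLowerDensityOn_selmerFour_of_selmerTwoAverage_of_neCubeTwo
    (hGood : Φ.HasDensityOn (fun a ↦ 2 ≤ a.curve.mordellWeilRank ∧
      Nat.card (AddSubgroup.torsionBy a.curve.toAffine.Point (2 : ℤ)) = 1) 1)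
    {A κ : ℝ} (hA : Φ.AverageOnLE (fun a ↦ (Nat.card (a.curve.selmerGroup 2) : ℝ)) A)
    (hK : Φ.DensityOnGE (fun a ↦ Nat.card (a.curve.selmerGroup 2) ≠ 8) κ) (hκ : 0 < κ)
    (hAκ : A < 8 + 8 * κ) :
    Φ.HasPositiveLowerDensityOn (fun a ↦ Nat.card (a.curve.selmerGroup 2) = 4) := by
  have hcap := averageOnLE_min Φ hA 16
  have h := hasPositiveLowerDensityOn_card_selmerGroup_eq_sq_of_cappedAverage_of_neCube Φ 2
    (by exact_mod_cast hGood) (A := A) (κ := κ) (by norm_num; exact hcap) (by norm_num; exact hK) hκ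
    (by norm_num; linarith)
  norm_num at h
  exact h

/-- **The weak leaf at `2`, Φ-local**: under the hypotheses of
`hasPositiveLowerDensityOn_selmerFour_of_selmerTwoAverage_of_neCubeTwo`, the members with
`rank E_a(ℚ) = 2` and `Ш(E_a)[2^∞] = 0` have positive lower density (K1 at `p = 2`:
`#Sel₂ = 4 ∧ rank ≥ 2 ∧ #E(ℚ)[2] = 1 ⇒ rank = 2 ∧ Ш[2^∞] = 0`, pure counting). [folklore] -/
theorem hasPositiveLowerDensityOn_rank_two_sha_two_of_selmerTwoAverage_of_neCubeTwo
    (hGood : Φ.HasDensityOn (fun a ↦ 2 ≤ a.curve.mordellWeilRank ∧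
      Nat.card (AddSubgroup.torsionBy a.curve.toAffine.Point (2 : ℤ)) = 1) 1)
    {A κ : ℝ} (hA : Φ.AverageOnLE (fun a ↦ (Nat.card (a.curve.selmerGroup 2) : ℝ)) A)
    (hK : Φ.DensityOnGE (fun a ↦ Nat.card (a.curve.selmerGroup 2) ≠ 8) κ) (hκ : 0 < κ)
    (hAκ : A < 8 + 8 * κ) :
    Φ.HasPositiveLowerDensityOn (fun a ↦ a.IsMember ∧ a.curve.mordellWeilRank = 2 ∧
      AddCommGroup.primaryComponent a.curve.sha 2 = ⊥) := by
  have hD : Φ.HasPositiveLowerDensityOn (fun a ↦ Nat.card (a.curve.selmerGroup 2) = 2 ^ 2) :=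
    hasPositiveLowerDensityOn_mono Φ
      (hasPositiveLowerDensityOn_selmerFour_of_selmerTwoAverage_of_neCubeTwo Φ hGood hA hK hκ hAκ)
      fun a h ↦ h.trans (by norm_num)
  exact hasPositiveLowerDensityOn_rank_two_sha_bot_of_card_selmerGroup_eq_sq Φ 2 hGood hD

/-! ### §2 BY NAME over large families: Bhargava–Ho's average + Y₂ ⇒ the weak leaf at `2` -/

/-- **`dens{#Sel₂ = 4} > 0` on every large family**, modulo the large-family facts (BH Thm 9.1/10.1:
trivial torsion and `rank ≥ 2` for `100 %`, I0), Bhargava–Ho's PROVED `2`-Selmer average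
`hBH : ∀ Φ large, limsup avg #Sel₂ ≤ 12` (Thm 1.1(g)/1.2) and the ONE open input
Y₂ «`liminf dens{#Sel₂ ≠ 8} > 1/2` on every large `Φ` with nonempty residue sets».
[cite: BhargavaHo2022, Thm. 1.1(g) and Thm. 1.2 (average 2-Selmer size at most 12 over large subfamilies of F₂)] -/
theorem selmerFourDensity_of_selmerTwoAverage_of_neCubeTwo (hLF : LargeFamilyInputsF2)
    (hBH : ∀ Φ : CongruenceFamily₂, Φ.IsLarge →
      Φ.AverageOnLE (fun a ↦ (Nat.card (a.curve.selmerGroup 2) : ℝ)) 12)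
    (hY₂ : ∀ Φ : CongruenceFamily₂, Φ.IsLarge → (∀ p : ℕ, p.Prime → (Φ.residues p).Nonempty) →
      ∃ κ : ℝ, 1 / 2 < κ ∧ Φ.DensityOnGE (fun a ↦ Nat.card (a.curve.selmerGroup 2) ≠ 8) κ)
    (Φ : CongruenceFamily₂) (hL : Φ.IsLarge) (hne : ∀ p : ℕ, p.Prime → (Φ.residues p).Nonempty) :
    Φ.HasPositiveLowerDensityOn (fun a ↦ Nat.card (a.curve.selmerGroup 2) = 4) := by
  obtain ⟨κ, hκ2, hK⟩ := hY₂ Φ hL hne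
  haveI : Fact (Nat.Prime 2) := ⟨Nat.prime_two⟩
  have hGood := hasDensityOn_rank_torsionBy_of_torsionOrder Φ 2 (genericMembersLargeF2 hLF Φ hL hne)
  exact hasPositiveLowerDensityOn_selmerFour_of_selmerTwoAverage_of_neCubeTwo Φ (by exact_mod_cast hGood)
    (hBH Φ hL) hK (by linarith) (by linarith)

/-- **The weak leaf at `2` on every large family** — «in every large `Φ ⊆ F₂` with a nonempty congruence
condition at every prime, the members with `rank E_a(ℚ) = 2` exactly and `Ш(E_a)[2^∞] = 0` have positive
lower density» — modulo PRINT (the large-family facts BH Thm 9.1/10.1 and Bhargava–Ho's `2`-Selmer average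
Thm 1.1(g)/1.2, hypothesis `hBH`) and the ONE open input Y₂ «`dens{#Sel₂ = 8}` has upper density
`< 1/2`» (Poonen–Rains `0.419`). Pure counting: no parity, no modularity, no Iwasawa theory, no height.
[cite: BhargavaHo2022, Thm. 1.1(g), Thm. 1.2, Thm. 9.1, Thm. 10.1] -/
theorem weakLeafAtTwo_of_selmerTwoAverage_of_neCubeTwo (hLF : LargeFamilyInputsF2)
    (hBH : ∀ Φ : CongruenceFamily₂, Φ.IsLarge →
      Φ.AverageOnLE (fun a ↦ (Nat.card (a.curve.selmerGroup 2) : ℝ)) 12)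
    (hY₂ : ∀ Φ : CongruenceFamily₂, Φ.IsLarge → (∀ p : ℕ, p.Prime → (Φ.residues p).Nonempty) →
      ∃ κ : ℝ, 1 / 2 < κ ∧ Φ.DensityOnGE (fun a ↦ Nat.card (a.curve.selmerGroup 2) ≠ 8) κ)
    (Φ : CongruenceFamily₂) (hL : Φ.IsLarge) (hne : ∀ p : ℕ, p.Prime → (Φ.residues p).Nonempty) :
    Φ.HasPositiveLowerDensityOn (fun a ↦ a.IsMember ∧ a.curve.mordellWeilRank = 2 ∧
      AddCommGroup.primaryComponent a.curve.sha 2 = ⊥) := by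
  obtain ⟨κ, hκ2, hK⟩ := hY₂ Φ hL hne
  haveI : Fact (Nat.Prime 2) := ⟨Nat.prime_two⟩
  have hGood := hasDensityOn_rank_torsionBy_of_torsionOrder Φ 2 (genericMembersLargeF2 hLF Φ hL hne)
  exact hasPositiveLowerDensityOn_rank_two_sha_two_of_selmerTwoAverage_of_neCubeTwo Φ
    (by exact_mod_cast hGood) (hBH Φ hL) hK (by linarith) (by linarith)

/-- **The weak leaf at `2` on the whole family `F₂`** (`Φ = all`: large, residue sets `univ`): a positive
proportion of `F₂`, ordered by height, has `rank = 2` and `Ш[2^∞] = 0` — modulo the same print inputs and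
Y₂. [cite: BhargavaHo2022, Thm. 1.1(g), Thm. 1.2, Thm. 10.1] -/
theorem weakLeafAtTwo_all_of_selmerTwoAverage_of_neCubeTwo (hLF : LargeFamilyInputsF2)
    (hBH : ∀ Φ : CongruenceFamily₂, Φ.IsLarge →
      Φ.AverageOnLE (fun a ↦ (Nat.card (a.curve.selmerGroup 2) : ℝ)) 12)
    (hY₂ : ∀ Φ : CongruenceFamily₂, Φ.IsLarge → (∀ p : ℕ, p.Prime → (Φ.residues p).Nonempty) →
      ∃ κ : ℝ, 1 / 2 < κ ∧ Φ.DensityOnGE (fun a ↦ Nat.card (a.curve.selmerGroup 2) ≠ 8) κ) :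
    CongruenceFamily₂.all.HasPositiveLowerDensityOn (fun a ↦ a.IsMember ∧
      a.curve.mordellWeilRank = 2 ∧ AddCommGroup.primaryComponent a.curve.sha 2 = ⊥) :=
  weakLeafAtTwo_of_selmerTwoAverage_of_neCubeTwo hLF hBH hY₂ _ CongruenceFamily₂.isLarge_all
    fun _ _ ↦ Set.univ_nonempty

/-- **The weak leaf at `2` on an explicit large family with NO fact pack**: on the refined door family of
`Theorems.exists_refinedDoorFamily_densities` (trivial torsion and `rank ≥ 2` MEMBER-WISE, by reduction
mod `3·7·13`) Bhargava–Ho's average (hypothesis `hBH`) and Y₂ give a positive lower density of members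
with `rank = 2 ∧ Ш[2^∞] = 0` — the only inputs are BH Thm 1.1(g)/1.2 and Y₂.
[cite: BhargavaHo2022, Thm. 1.1(g) and Thm. 1.2] -/
theorem exists_weakLeafAtTwo_of_selmerTwoAverage_of_neCubeTwo
    (hBH : ∀ Φ : CongruenceFamily₂, Φ.IsLarge →
      Φ.AverageOnLE (fun a ↦ (Nat.card (a.curve.selmerGroup 2) : ℝ)) 12)
    (hY₂ : ∀ Φ : CongruenceFamily₂, Φ.IsLarge → (∀ p : ℕ, p.Prime → (Φ.residues p).Nonempty) →
      ∃ κ : ℝ, 1 / 2 < κ ∧ Φ.DensityOnGE (fun a ↦ Nat.card (a.curve.selmerGroup 2) ≠ 8) κ) :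
    ∃ Φ : CongruenceFamily₂, Φ.IsLarge ∧ (∀ p : ℕ, p.Prime → (Φ.residues p).Nonempty) ∧
      Φ.HasPositiveLowerDensityOn (fun a ↦ a.IsMember ∧ a.curve.mordellWeilRank = 2 ∧
        AddCommGroup.primaryComponent a.curve.sha 2 = ⊥) := by
  obtain ⟨Φ, hL, hne, -, hGen, -⟩ := exists_refinedDoorFamily_densities
  obtain ⟨κ, hκ2, hK⟩ := hY₂ Φ hL hne
  haveI : Fact (Nat.Prime 2) := ⟨Nat.prime_two⟩
  have hGood := hasDensityOn_rank_torsionBy_of_torsionOrder Φ 2 hGen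
  exact ⟨Φ, hL, hne, hasPositiveLowerDensityOn_rank_two_sha_two_of_selmerTwoAverage_of_neCubeTwo Φ
    (by exact_mod_cast hGood) (hBH Φ hL) hK (by linarith) (by linarith)⟩

/-! ### §3 Feeders of Y₂: sign + odd tail (they add); the tail alone -/

/-- **Sign and odd tail feed Y₂** (modulo the large-family facts and Dokchitser–Dokchitser / Monsky
`2`-parity): if on every large `Φ` with nonempty residue sets `liminf dens{w = +1} ≥ ρ` and
`liminf dens{w = −1 ∧ #Sel₂ ≥ 16} ≥ z` with `ρ + z > 1/2`, then Y₂ holds. Under Poonen–Rains `ρ = 1/2` (tie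
alone) and the odd tail `z ≈ .08`; their sum clears `1/2`. [cite: DokchitserDokchitserAnnals2010, Thm 1.4 (p-parity, p = 2: Monsky)] -/
theorem neCubeTwoDensity_of_rootNumber_add_oddTail (hLF : LargeFamilyInputsF2)
    (hDD : even_selmerRank_sub_torsionRank_iff)
    (h : ∀ Φ : CongruenceFamily₂, Φ.IsLarge → (∀ p : ℕ, p.Prime → (Φ.residues p).Nonempty) →
      ∃ ρ z : ℝ, 1 / 2 < ρ + z ∧ Φ.DensityOnGE (fun a ↦ a.curve.rootNumber = 1) ρ ∧
        Φ.DensityOnGE (fun a ↦ a.curve.rootNumber = -1 ∧ 2 ^ 4 ≤ Nat.card (a.curve.selmerGroup 2)) z)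
    (Φ : CongruenceFamily₂) (hL : Φ.IsLarge) (hne : ∀ p : ℕ, p.Prime → (Φ.residues p).Nonempty) :
    ∃ κ : ℝ, 1 / 2 < κ ∧ Φ.DensityOnGE (fun a ↦ Nat.card (a.curve.selmerGroup 2) ≠ 8) κ := by
  obtain ⟨ρ, z, hρz, hW, hT⟩ := h Φ hL hne
  haveI : Fact (Nat.Prime 2) := ⟨Nat.prime_two⟩
  have hGood := hasDensityOn_rank_torsionBy_of_torsionOrder Φ 2 (genericMembersLargeF2 hLF Φ hL hne)
  have hK := densityOnGE_neCube_of_rootNumber_add_oddTail Φ 2 hDD (by exact_mod_cast hGood) hW hT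
  exact ⟨ρ + z, hρz, by norm_num at hK; exact hK⟩

/-- **The tail alone feeds Y₂** (fact-free; numerically idle: Poonen–Rains gives `dens{#Sel₂ ≥ 16} = .371`,
below the needed `1/2`): `dens{16 ≤ #Sel₂} > 1/2` on every large `Φ` with nonempty residue sets implies Y₂.
[folklore] -/
theorem neCubeTwoDensity_of_selmerTwoTail
    (hZ₂ : ∀ Φ : CongruenceFamily₂, Φ.IsLarge → (∀ p : ℕ, p.Prime → (Φ.residues p).Nonempty) →
      ∃ ζ : ℝ, 1 / 2 < ζ ∧ Φ.DensityOnGE (fun a ↦ 16 ≤ Nat.card (a.curve.selmerGroup 2)) ζ)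
    (Φ : CongruenceFamily₂) (hL : Φ.IsLarge) (hne : ∀ p : ℕ, p.Prime → (Φ.residues p).Nonempty) :
    ∃ κ : ℝ, 1 / 2 < κ ∧ Φ.DensityOnGE (fun a ↦ Nat.card (a.curve.selmerGroup 2) ≠ 8) κ := by
  obtain ⟨ζ, hζ2, hT⟩ := hZ₂ Φ hL hne
  haveI : Fact (Nat.Prime 2) := ⟨Nat.prime_two⟩
  have h := densityOnGE_neCube_of_tail Φ 2 (ζ := ζ) (by norm_num; exact hT)
  exact ⟨ζ, hζ2, by norm_num at h; exact h⟩

/-! ### §4 Minimal inputs on `F₂` itself; the root-number reading of Y₂ -/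

/-- **«A positive proportion of `F₂` has `rank = 2` exactly and `Ш[2^∞] = 0`» from MINIMAL inputs**:
Bhargava–Ho Thm 10.1 (`thm10_1_F2`: trivial torsion and `rank ≥ 2` for `100 %` of `F₂`), the `F₂` clause
of Thm 1.1(g) ALONE (`limsup avg #Sel₂ ≤ 12` over `F₂`, hypothesis `hBH`; Thm 1.2 is not needed for
`Φ = F₂`), and Y₂ on `F₂` only («`liminf dens{#Sel₂ ≠ 8} > 1/2`»). Pure counting (K1 at `2`).
[cite: BhargavaHo2022, Thm. 1.1(g) and Thm. 10.1] -/
theorem weakLeafAtTwo_all_of_thm10_1 (h101 : thm10_1_F2)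
    (hBH : CongruenceFamily₂.all.AverageOnLE (fun a ↦ (Nat.card (a.curve.selmerGroup 2) : ℝ)) 12)
    (hY₂ : ∃ κ : ℝ, 1 / 2 < κ ∧
      CongruenceFamily₂.all.DensityOnGE (fun a ↦ Nat.card (a.curve.selmerGroup 2) ≠ 8) κ) :
    CongruenceFamily₂.all.HasPositiveLowerDensityOn (fun a ↦ a.IsMember ∧
      a.curve.mordellWeilRank = 2 ∧ AddCommGroup.primaryComponent a.curve.sha 2 = ⊥) := by
  obtain ⟨κ, hκ2, hK⟩ := hY₂
  haveI : Fact (Nat.Prime 2) := ⟨Nat.prime_two⟩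
  have hGood := hasDensityOn_rank_torsionBy_of_torsionOrder CongruenceFamily₂.all 2
    (thm10_1_F2.hasDensityOn_and h101)
  exact hasPositiveLowerDensityOn_rank_two_sha_two_of_selmerTwoAverage_of_neCubeTwo _
    (by exact_mod_cast hGood) hBH hK (by linarith) (by linarith)

/-- **The root-number reading of Y₂** (modulo the large-family facts and `2`-parity): by parity the level
set `{#Sel₂ = 8}` is `{w = −1} ∖ {w = −1 ∧ #Sel₂ ≥ 32}` on the `100 %` set, so Y₂ holds as soon as
`liminf dens{w = +1} ≥ ρ` and `liminf dens{w = −1 ∧ #Sel₂ ≥ 32} ≥ z` with `ρ + z > 1/2` (the `≥ 32` tail is the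
honest odd tail: `w = −1` members never have `#Sel₂ = 16`). HONESTY: under Poonen–Rains `z ≈ 0.08`, so Y₂ asks
for root-number NEAR-equidistribution `ρ > 1/2 − z ≈ 0.42` — a TIGHTER root-number demand than I2's `ρ > 1/6`
(same parity wall, less slack), traded against the `3`-Selmer average I1 becoming Bhargava–Ho's theorem at `2`.
Cell census (tuple-weighted, `H < 10⁶/10⁷/10⁸`): `dens{w = −1} = .403/.452/.480`,
`dens{w = −1 ∧ #Sel₂ ≥ 32} = .0002/.0011/.0051`, `dens{#Sel₂ = 8} = .403/.450/.474` (2-parity holds on every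
census member). [cite: DokchitserDokchitserAnnals2010, Thm 1.4 (p-parity; p = 2: Monsky)] -/
theorem neCubeTwoDensity_of_rootNumber_add_oddTail32 (hLF : LargeFamilyInputsF2)
    (hDD : even_selmerRank_sub_torsionRank_iff)
    (h : ∀ Φ : CongruenceFamily₂, Φ.IsLarge → (∀ p : ℕ, p.Prime → (Φ.residues p).Nonempty) →
      ∃ ρ z : ℝ, 1 / 2 < ρ + z ∧ Φ.DensityOnGE (fun a ↦ a.curve.rootNumber = 1) ρ ∧
        Φ.DensityOnGE (fun a ↦ a.curve.rootNumber = -1 ∧ 32 ≤ Nat.card (a.curve.selmerGroup 2)) z)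
    (Φ : CongruenceFamily₂) (hL : Φ.IsLarge) (hne : ∀ p : ℕ, p.Prime → (Φ.residues p).Nonempty) :
    ∃ κ : ℝ, 1 / 2 < κ ∧ Φ.DensityOnGE (fun a ↦ Nat.card (a.curve.selmerGroup 2) ≠ 8) κ := by
  refine neCubeTwoDensity_of_rootNumber_add_oddTail hLF hDD (fun Ψ hΨ hneΨ ↦ ?_) Φ hL hne
  obtain ⟨ρ, z, hρz, hW, hT⟩ := h Ψ hΨ hneΨ
  exact ⟨ρ, z, hρz, hW, densityOnGE_mono Ψ hT fun a ha ↦ ⟨ha.1, le_trans (by norm_num) ha.2⟩⟩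

end Summit.BirchSwinnertonDyer.BirchSwinnertonDyer.Theorems

end
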